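import Summits.QuantumFields.YangMills.Theorems.BalabanLadderROTSkewTorus
import Summits.QuantumFields.YangMills.Theorems.BalabanLadderROTClassDefs
import HarnessLib

/-!
# Crux `ROT` (stmt-QuantumFields-20042): integer rotations of Pythagorean triples and the period lattice of the TILTED torus

Helper file of cell `ym-beyond`, seat p4 (generation g18) — part 1 of its `BalabanLadderROTTiltCells.lean` (3fb7bad633ed4262), split at
the 400-line limit and filed by the fleet lead `ym-spine-20042-p1` (g3), `--supports stmt-QuantumFields-20042 --as helper`; companion of
`Theorems/BalabanLadderROTSkewTorus.lean` (`PeriodCell`, Wilson's theory on a skew torus).  Part 2 (`Theorems/BalabanLadderROTTiltCells.lean`)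
builds the cells.

For a Pythagorean triple `t = (p, s, q)` (`p² + s² = q²`, `0 < q`) the integer matrix `rotZ t = q·R_θ` (`cos θ = p/q`,
`sin θ = s/q`; `siteToE_rotZ`) and its adjugate-type partner `rotZinv t = q·R_θ⁻¹` (`rotZ_rotZinv : rotZ (rotZinv z) = q² z`)
act on `ℤ⁴` (rotation in the `(x₀,x₁)`-plane, as `planeRot (0 : Fin 3) θ`).  For a block count `m ≥ 1` (torus side `N = m q`
in lattice units) the period lattice of the axis lattice `ℤ⁴` on the TILTED torus is `P = m·rotZinv(ℤ⁴) = R_θ⁻¹(Nℤ⁴)`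
(`planeRot_siteToE_period : R_θ (m·rotZinv z) = N z`), of index `N⁴`; §3 supplies the transversal
`window t m = {y : −m q² ≤ 2 (rotZ y)ᵢ < m q²}` (the half-open rotated box) and the explicit Euclidean-division reduction `reduce t m`
(`reduce_mem_window`, `reduce_eq_self_of_mem`, `reduce_add_period`).  Instances: King's `(4,3,5)` and the Bałaban-admissible `(12,5,13)`.

Pure integer / trigonometric bookkeeping; nothing asserted about Yang–Mills.  No instance, no named fact, no sorry.
Reference for the geometry: C. King, Commun. Math. Phys. **103** (1986) 323–349, §2 (p. 326–327, (2.24)–(2.25)).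
-/

set_option autoImplicit false

noncomputable section

open scoped BigOperators
open Real
open Literature.MathematicalPhysics.QuantumFieldTheory Literature.MathematicalPhysics.QuantumLattice
open Literature.Probability.LatticeModels (box Site mem_box)

namespace Summit.QuantumFields.YangMills.Theorems.ROT

/-- A Pythagorean triple `p² + s² = q²` with `q > 0` (signs of `p`, `s` free): the rotation by `θ`, `cos θ = p/q`,
`sin θ = s/q`, maps `q·ℤ⁴` into `ℤ⁴`. -/
structure PythTriple where
  p : ℤ
  s : ℤ
  q : ℕ
  q_pos : 0 < q
  pyth : p ^ 2 + s ^ 2 = (q : ℤ) ^ 2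

namespace PythTriple

/-- King's triple `(4, 3, 5)`: `θ = arcsin (3/5)` (C. King, CMP 103 (1986) p. 326). -/
def king345 : PythTriple := ⟨4, 3, 5, by norm_num, by norm_num⟩

/-- The Bałaban-admissible triple `(12, 5, 13)`: `θ = arcsin (5/13)`, odd block factor `13 > 11` (N-ROT-NODE-MEMO v2 §2). -/
def bal51213 : PythTriple := ⟨12, 5, 13, by norm_num, by norm_num⟩

variable (t : PythTriple)

/-- The modulus is a nonzero integer. [folklore] -/
theorem q_ne_zero : (t.q : ℤ) ≠ 0 := by exact_mod_cast t.q_pos.ne'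

/-- `|p| ≤ q`. [folklore] -/
theorem abs_p_le : |t.p| ≤ t.q :=
  abs_le_of_sq_le_sq' (by nlinarith [t.pyth, sq_nonneg t.s]) (by positivity) |> fun h => abs_le.2 h

/-- `|s| ≤ q`. [folklore] -/
theorem abs_s_le : |t.s| ≤ t.q :=
  abs_le_of_sq_le_sq' (by nlinarith [t.pyth, sq_nonneg t.p]) (by positivity) |> fun h => abs_le.2 h

/-! ## §1 The integer rotations `q·R_θ` and `q·R_θ⁻¹` -/

/-- `rotZ t = q·R_θ` on `ℤ⁴`: `(x₀,x₁,x₂,x₃) ↦ (p x₀ + s x₁, −s x₀ + p x₁, q x₂, q x₃)`. -/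
def rotZ : Site 4 →+ Site 4 where
  toFun x := ![t.p * x 0 + t.s * x 1, -t.s * x 0 + t.p * x 1, (t.q : ℤ) * x 2, (t.q : ℤ) * x 3]
  map_zero' := by
    ext i; fin_cases i <;> simp
  map_add' x y := by
    ext i; fin_cases i <;> simp <;> ring

/-- `rotZinv t = q·R_θ⁻¹` on `ℤ⁴`: `(x₀,x₁,x₂,x₃) ↦ (p x₀ − s x₁, s x₀ + p x₁, q x₂, q x₃)`. -/
def rotZinv : Site 4 →+ Site 4 where
  toFun x := ![t.p * x 0 - t.s * x 1, t.s * x 0 + t.p * x 1, (t.q : ℤ) * x 2, (t.q : ℤ) * x 3]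
  map_zero' := by
    ext i; fin_cases i <;> simp
  map_add' x y := by
    ext i; fin_cases i <;> simp <;> ring

/-- Component `0` of `rotZ`. [folklore] -/
@[simp] theorem rotZ_apply_zero (x : Site 4) : t.rotZ x 0 = t.p * x 0 + t.s * x 1 := rfl
/-- Component `1` of `rotZ`. [folklore] -/
@[simp] theorem rotZ_apply_one (x : Site 4) : t.rotZ x 1 = -t.s * x 0 + t.p * x 1 := rfl
/-- Component `2` of `rotZ`. [folklore] -/
@[simp] theorem rotZ_apply_two (x : Site 4) : t.rotZ x 2 = (t.q : ℤ) * x 2 := rfl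
/-- Component `3` of `rotZ`. [folklore] -/
@[simp] theorem rotZ_apply_three (x : Site 4) : t.rotZ x 3 = (t.q : ℤ) * x 3 := rfl
/-- Component `0` of `rotZinv`. [folklore] -/
@[simp] theorem rotZinv_apply_zero (x : Site 4) : t.rotZinv x 0 = t.p * x 0 - t.s * x 1 := rfl
/-- Component `1` of `rotZinv`. [folklore] -/
@[simp] theorem rotZinv_apply_one (x : Site 4) : t.rotZinv x 1 = t.s * x 0 + t.p * x 1 := rfl
/-- Component `2` of `rotZinv`. [folklore] -/
@[simp] theorem rotZinv_apply_two (x : Site 4) : t.rotZinv x 2 = (t.q : ℤ) * x 2 := rfl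
/-- Component `3` of `rotZinv`. [folklore] -/
@[simp] theorem rotZinv_apply_three (x : Site 4) : t.rotZinv x 3 = (t.q : ℤ) * x 3 := rfl

/-- `rotZ ∘ rotZinv = q²`. -/
theorem rotZ_rotZinv (z : Site 4) : t.rotZ (t.rotZinv z) = ((t.q : ℤ) ^ 2) • z := by
  ext i
  fin_cases i
  · simp; linear_combination (z 0) * t.pyth
  · simp; linear_combination (z 1) * t.pyth
  · simp; ring
  · simp; ring

/-- `rotZinv ∘ rotZ = q²`. -/
theorem rotZinv_rotZ (y : Site 4) : t.rotZinv (t.rotZ y) = ((t.q : ℤ) ^ 2) • y := by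
  ext i
  fin_cases i
  · simp; linear_combination (y 0) * t.pyth
  · simp; linear_combination (y 1) * t.pyth
  · simp; ring
  · simp; ring

/-- `rotZ t` is `q` times the plane rotation `planeRot 0 θ` whenever `cos θ = p/q`, `sin θ = s/q`. -/
theorem siteToE_rotZ (θ : ℝ) (hc : Real.cos θ = t.p / t.q) (hs : Real.sin θ = t.s / t.q) (y : Site 4) :
    siteToE (t.rotZ y) = (t.q : ℝ) • planeRot (0 : Fin 3) θ (siteToE y) := by
  have hq : (t.q : ℝ) ≠ 0 := by exact_mod_cast t.q_pos.ne'
  have h1 : ((0 : Fin 3).succ : Fin 4) = 1 := rfl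
  ext j
  rw [PiLp.smul_apply, planeRot_apply, h1, siteToE_apply, siteToE_apply, siteToE_apply, hc, hs, smul_eq_mul]
  fin_cases j
  · simp; field_simp
  · simp; field_simp
  · simp [siteToE_apply]
  · simp [siteToE_apply]

/-- `rotZinv t` is `q` times the inverse plane rotation: `R_θ (rotZinv z) = q z`. -/
theorem planeRot_siteToE_rotZinv (θ : ℝ) (hc : Real.cos θ = t.p / t.q) (hs : Real.sin θ = t.s / t.q) (z : Site 4) :
    planeRot (0 : Fin 3) θ (siteToE (t.rotZinv z)) = (t.q : ℝ) • siteToE z := by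
  have hq : (t.q : ℝ) ≠ 0 := by exact_mod_cast t.q_pos.ne'
  have hp : (t.p : ℝ) ^ 2 + (t.s : ℝ) ^ 2 = (t.q : ℝ) ^ 2 := by exact_mod_cast t.pyth
  have h1 : ((0 : Fin 3).succ : Fin 4) = 1 := rfl
  ext j
  rw [PiLp.smul_apply, planeRot_apply, h1, siteToE_apply, siteToE_apply, siteToE_apply, hc, hs, smul_eq_mul]
  fin_cases j
  · simp; field_simp; linear_combination (z 0 : ℝ) * hp
  · simp; field_simp; linear_combination (z 1 : ℝ) * hp
  · simp [siteToE_apply]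
  · simp [siteToE_apply]

/-! ## §2 The period lattice `P = m·rotZinv(ℤ⁴) = R_θ⁻¹(Nℤ⁴)`, `N = m q` -/

/-- The period lattice of the axis lattice on the tilted torus of side `N = m q`: `m·rotZinv(ℤ⁴)`. -/
def periods (m : ℕ) : AddSubgroup (Site 4) where
  carrier := {x | ∃ z : Site 4, x = (m : ℤ) • t.rotZinv z}
  zero_mem' := ⟨0, by rw [map_zero, smul_zero]⟩
  add_mem' := by
    rintro _ _ ⟨z, rfl⟩ ⟨w, rfl⟩
    exact ⟨z + w, by rw [map_add, smul_add]⟩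
  neg_mem' := by
    rintro _ ⟨z, rfl⟩
    exact ⟨-z, by rw [map_neg, smul_neg]⟩

/-- Membership in the period lattice, unfolded. [folklore] -/
theorem mem_periods {m : ℕ} {x : Site 4} : x ∈ t.periods m ↔ ∃ z : Site 4, x = (m : ℤ) • t.rotZinv z := Iff.rfl

/-- **The tilted period lattice rotates onto the straight one**: `R_θ (m·rotZinv z) = (m q) z`.  So under the tilted embedding
`y ↦ R_θ(a y)` the periods become `a N ℤ⁴` (the straight torus of side `aN`), and under the axis embedding `y ↦ a y` they are
`R_θ⁻¹(aNℤ⁴)` (the tilted torus). -/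
theorem planeRot_siteToE_period (θ : ℝ) (hc : Real.cos θ = t.p / t.q) (hs : Real.sin θ = t.s / t.q) (m : ℕ) (z : Site 4) :
    planeRot (0 : Fin 3) θ (siteToE ((m : ℤ) • t.rotZinv z)) = ((m * t.q : ℕ) : ℝ) • siteToE z := by
  have hlin : siteToE ((m : ℤ) • t.rotZinv z) = (m : ℝ) • siteToE (t.rotZinv z) := by
    ext j
    rw [siteToE_apply, PiLp.smul_apply, siteToE_apply, Pi.smul_apply, smul_eq_mul, smul_eq_mul]
    push_cast
    rfl
  rw [hlin, LinearIsometryEquiv.map_smul, t.planeRot_siteToE_rotZinv θ hc hs, smul_smul, Nat.cast_mul]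

/-! ## §3 The transversal (rotated half-open box) and the Euclidean-division reduction -/

/-- The modulus `M = m q²` (`= N q`). -/
def modulus (m : ℕ) : ℤ := (m : ℤ) * (t.q : ℤ) ^ 2

/-- The modulus `m q²` is positive for `m ≥ 1`. [folklore] -/
theorem modulus_pos {m : ℕ} (hm : 0 < m) : 0 < t.modulus m := by
  unfold modulus
  have := t.q_pos
  positivity

/-- The coset index of `y`: `nᵢ = ⌊(2 (rotZ y)ᵢ + M) / 2M⌋`. -/
def cosetIndex (m : ℕ) (y : Site 4) : Site 4 := fun i => (2 * t.rotZ y i + t.modulus m) / (2 * t.modulus m)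

/-- The reduction `y ↦ y − m·rotZinv(n(y))` into the rotated half-open box. -/
def reduce (m : ℕ) (y : Site 4) : Site 4 := y - (m : ℤ) • t.rotZinv (t.cosetIndex m y)

/-- The transversal: sites of the box of radius `m q²` whose rotated doubled coordinates lie in `[−M, M)`. -/
def window (m : ℕ) : Finset (Site 4) :=
  (box 4 (m * t.q ^ 2)).filter fun y => ∀ i, -t.modulus m ≤ 2 * t.rotZ y i ∧ 2 * t.rotZ y i < t.modulus m

/-- Membership in the rotated half-open box, unfolded. [folklore] -/
theorem mem_window {m : ℕ} {y : Site 4} :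
    y ∈ t.window m ↔ y ∈ box 4 (m * t.q ^ 2) ∧ ∀ i, -t.modulus m ≤ 2 * t.rotZ y i ∧ 2 * t.rotZ y i < t.modulus m := by
  simp only [window, Finset.mem_filter]

/-- Rotating a period: `rotZ (y + m·rotZinv z) = rotZ y + M z`. -/
theorem rotZ_add_period (m : ℕ) (y z : Site 4) (i : Fin 4) :
    t.rotZ (y + (m : ℤ) • t.rotZinv z) i = t.rotZ y i + t.modulus m * z i := by
  rw [map_add, map_zsmul, t.rotZ_rotZinv, Pi.add_apply, Pi.smul_apply, Pi.smul_apply, smul_eq_mul, smul_eq_mul, modulus]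
  ring

/-- Rotating the reduction: `rotZ (reduce y) = rotZ y − M n(y)`. -/
theorem rotZ_reduce (m : ℕ) (y : Site 4) (i : Fin 4) :
    t.rotZ (t.reduce m y) i = t.rotZ y i - t.modulus m * t.cosetIndex m y i := by
  rw [reduce, map_sub, map_zsmul, t.rotZ_rotZinv, Pi.sub_apply, Pi.smul_apply, Pi.smul_apply, smul_eq_mul, smul_eq_mul,
    modulus]
  ring

/-- The reduction lands in the rotated half-open box. -/
theorem reduce_bounds {m : ℕ} (hm : 0 < m) (y : Site 4) (i : Fin 4) :
    -t.modulus m ≤ 2 * t.rotZ (t.reduce m y) i ∧ 2 * t.rotZ (t.reduce m y) i < t.modulus m := by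
  rw [t.rotZ_reduce]
  have hM := t.modulus_pos hm
  set M := t.modulus m with hMdef
  have hb : (0 : ℤ) < 2 * M := by linarith
  set a := 2 * t.rotZ y i + M with ha
  have hn : t.cosetIndex m y i = a / (2 * M) := rfl
  rw [hn]
  have h1 := Int.mul_ediv_add_emod a (2 * M)
  have h2 := Int.emod_nonneg a hb.ne'
  have h3 := Int.emod_lt_of_pos a hb
  set n := a / (2 * M) with hndef
  constructor <;> linarith

/-- A window bound on the rotated coordinates bounds the site: `|yⱼ| ≤ m q²`. -/
theorem abs_le_of_bounds {m : ℕ} {y : Site 4} (h : ∀ i, -t.modulus m ≤ 2 * t.rotZ y i ∧ 2 * t.rotZ y i < t.modulus m)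
    (j : Fin 4) : |y j| ≤ (m : ℤ) * (t.q : ℤ) ^ 2 := by
  have hq : (0 : ℤ) < t.q := by exact_mod_cast t.q_pos
  have hM0 : 0 ≤ t.modulus m := by unfold modulus; positivity
  have hab : ∀ i, |2 * t.rotZ y i| ≤ t.modulus m := fun i => abs_le.2 ⟨(h i).1, (h i).2.le⟩
  have hp := t.abs_p_le
  have hs := t.abs_s_le
  -- `q |yⱼ| ≤ M`
  have key : (t.q : ℤ) * |y j| ≤ t.modulus m := by
    fin_cases j
    · show (t.q : ℤ) * |y 0| ≤ t.modulus m
      have e : 2 * (t.q : ℤ) ^ 2 * y 0 = t.p * (2 * t.rotZ y 0) - t.s * (2 * t.rotZ y 1) := by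
        simp; linear_combination (-2 * y 0) * t.pyth
      have h2 : 2 * (t.q : ℤ) ^ 2 * |y 0| ≤ 2 * (t.q : ℤ) * t.modulus m := by
        calc 2 * (t.q : ℤ) ^ 2 * |y 0| = |2 * (t.q : ℤ) ^ 2 * y 0| := by
              rw [abs_mul, abs_of_pos (by positivity : (0 : ℤ) < 2 * (t.q : ℤ) ^ 2)]
          _ = |t.p * (2 * t.rotZ y 0) - t.s * (2 * t.rotZ y 1)| := by rw [e]
          _ ≤ |t.p * (2 * t.rotZ y 0)| + |t.s * (2 * t.rotZ y 1)| := abs_sub _ _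
          _ = |t.p| * |2 * t.rotZ y 0| + |t.s| * |2 * t.rotZ y 1| := by rw [abs_mul t.p, abs_mul t.s]
          _ ≤ (t.q : ℤ) * t.modulus m + (t.q : ℤ) * t.modulus m :=
              add_le_add (mul_le_mul hp (hab 0) (abs_nonneg _) hq.le) (mul_le_mul hs (hab 1) (abs_nonneg _) hq.le)
          _ = 2 * (t.q : ℤ) * t.modulus m := by ring
      have h3 : (2 * (t.q : ℤ)) * ((t.q : ℤ) * |y 0|) ≤ (2 * (t.q : ℤ)) * t.modulus m := by
        calc (2 * (t.q : ℤ)) * ((t.q : ℤ) * |y 0|) = 2 * (t.q : ℤ) ^ 2 * |y 0| := by ring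
          _ ≤ _ := h2
      exact le_of_mul_le_mul_left h3 (by positivity)
    · show (t.q : ℤ) * |y 1| ≤ t.modulus m
      have e : 2 * (t.q : ℤ) ^ 2 * y 1 = t.s * (2 * t.rotZ y 0) + t.p * (2 * t.rotZ y 1) := by
        simp; linear_combination (-2 * y 1) * t.pyth
      have h2 : 2 * (t.q : ℤ) ^ 2 * |y 1| ≤ 2 * (t.q : ℤ) * t.modulus m := by
        calc 2 * (t.q : ℤ) ^ 2 * |y 1| = |2 * (t.q : ℤ) ^ 2 * y 1| := by
              rw [abs_mul, abs_of_pos (by positivity : (0 : ℤ) < 2 * (t.q : ℤ) ^ 2)]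
          _ = |t.s * (2 * t.rotZ y 0) + t.p * (2 * t.rotZ y 1)| := by rw [e]
          _ ≤ |t.s * (2 * t.rotZ y 0)| + |t.p * (2 * t.rotZ y 1)| := abs_add_le _ _
          _ = |t.s| * |2 * t.rotZ y 0| + |t.p| * |2 * t.rotZ y 1| := by rw [abs_mul t.s, abs_mul t.p]
          _ ≤ (t.q : ℤ) * t.modulus m + (t.q : ℤ) * t.modulus m :=
              add_le_add (mul_le_mul hs (hab 0) (abs_nonneg _) hq.le) (mul_le_mul hp (hab 1) (abs_nonneg _) hq.le)
          _ = 2 * (t.q : ℤ) * t.modulus m := by ring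
      have h3 : (2 * (t.q : ℤ)) * ((t.q : ℤ) * |y 1|) ≤ (2 * (t.q : ℤ)) * t.modulus m := by
        calc (2 * (t.q : ℤ)) * ((t.q : ℤ) * |y 1|) = 2 * (t.q : ℤ) ^ 2 * |y 1| := by ring
          _ ≤ _ := h2
      exact le_of_mul_le_mul_left h3 (by positivity)
    · show (t.q : ℤ) * |y 2| ≤ t.modulus m
      have e : |2 * t.rotZ y 2| = 2 * ((t.q : ℤ) * |y 2|) := by
        rw [rotZ_apply_two, abs_mul, abs_mul, abs_two, abs_of_pos hq]
      have h2 := hab 2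
      rw [e] at h2
      nlinarith [abs_nonneg (y 2)]
    · show (t.q : ℤ) * |y 3| ≤ t.modulus m
      have e : |2 * t.rotZ y 3| = 2 * ((t.q : ℤ) * |y 3|) := by
        rw [rotZ_apply_three, abs_mul, abs_mul, abs_two, abs_of_pos hq]
      have h2 := hab 3
      rw [e] at h2
      nlinarith [abs_nonneg (y 3)]
  -- `|yⱼ| ≤ q |yⱼ| ≤ M = m q²`
  have h1 : |y j| ≤ (t.q : ℤ) * |y j| := le_mul_of_one_le_left (abs_nonneg _) (by exact_mod_cast t.q_pos)
  exact h1.trans (key.trans (le_of_eq rfl))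

/-- The reduction lands in the window. [folklore] -/
theorem reduce_mem_window {m : ℕ} (hm : 0 < m) (y : Site 4) : t.reduce m y ∈ t.window m := by
  rw [mem_window, mem_box]
  refine ⟨fun j => ?_, t.reduce_bounds hm y⟩
  have := abs_le.1 (t.abs_le_of_bounds (t.reduce_bounds hm y) j)
  push_cast
  exact this

/-- The reduction fixes the window. [folklore] -/
theorem reduce_eq_self_of_mem {m : ℕ} (hm : 0 < m) {y : Site 4} (hy : y ∈ t.window m) : t.reduce m y = y := by
  have hn : t.cosetIndex m y = 0 := by
    funext i
    have hi := ((t.mem_window).1 hy).2 i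
    have hM := t.modulus_pos hm
    show (2 * t.rotZ y i + t.modulus m) / (2 * t.modulus m) = 0
    exact Int.ediv_eq_zero_of_lt (by linarith) (by linarith)
  rw [reduce, hn, map_zero, smul_zero, sub_zero]

/-- The reduction is invariant under the periods. [folklore] -/
theorem reduce_add_period {m : ℕ} (hm : 0 < m) (y z : Site 4) :
    t.reduce m (y + (m : ℤ) • t.rotZinv z) = t.reduce m y := by
  have hM := t.modulus_pos hm
  have hn : t.cosetIndex m (y + (m : ℤ) • t.rotZinv z) = t.cosetIndex m y + z := by
    funext i
    show (2 * t.rotZ (y + (m : ℤ) • t.rotZinv z) i + t.modulus m) / (2 * t.modulus m) =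
      (2 * t.rotZ y i + t.modulus m) / (2 * t.modulus m) + z i
    rw [t.rotZ_add_period, show 2 * (t.rotZ y i + t.modulus m * z i) + t.modulus m =
      (2 * t.rotZ y i + t.modulus m) + z i * (2 * t.modulus m) by ring]
    exact Int.add_mul_ediv_right _ _ (by linarith)
  rw [reduce, hn, map_add, smul_add, reduce]
  abel

end PythTriple

end Summit.QuantumFields.YangMills.Theorems.ROT

end
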